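import Summits.ResolutionOfSingularities.ResolutionOfSingularities.Theorems.UniversalCellsCampaignW82FrobeniusTwistLinks
import Summits.ResolutionOfSingularities.ResolutionOfSingularities.Theorems.UniversalCellsCampaignW82RegularFormProofs
import HarnessLib

/-!
# [OURS · L1 W8.2] Both door cruxes hang on smoothing REGULAR varieties by Frobenius twists — links

Cell `res-hironaka`, LADDER-RESOLUTION rung L (RESCUE), slot W8.2; prover res-L1-s82-pv-1 (gen 2). Leaf file in
the existing Theses-importing cone of Theorems/UniversalCellsCampaignW82FrobeniusTwistLinks.lean; pure logic on
top of the Theses-free `CampaignW82.frobeniusTwistStepAt_iff_regular`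
(Theorems/UniversalCellsCampaignW82RegularFormProofs.lean, p485872).

WHAT IS PROVED (no new mathematics; by-name rewiring to the regular normal form):
* `primeFieldToPerfect_of_forall_frobeniusTwistStepRegularAt_top` — the crux `UniversalCells.PrimeFieldToPerfect`
  (stmt-ResolutionOfSingularities-15233) follows from: for every prime `p` and every perfect `M` of
  characteristic `p` with resolution over `M(t)`, every REGULAR irreducible geometrically reduced variety over
  `M(t)` has a Frobenius twist with a SMOOTH proper birational model over `M(t)`.
* `primeModelTransfer_of_forall_frobeniusTwistStepRegularAt_algClosureFg_top` — the crux
  `UniformComplexity.PrimeModelTransfer` (stmt-ResolutionOfSingularities-8933) from the same at the countably many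
  constant fields `M = (𝔽_p(s))^{alg} ∩ K`.
* `frobeniusTwistStepRegularAt_of_resolutionInChar` — conversely every instance follows from the summit.

HONEST FRAMING. OURS work of the rescue rung; NOT a statement of the manuscript (role replaced: [Hironaka2017]
§17 ¶2 / §2 p.4, see the statement file p485672); no external premise; AI work, weaker than expert review.
-/

noncomputable section

set_option linter.dupNamespace false -- mandated namespace of this single-conjunct summit

open _root_.CategoryTheory _root_.CategoryTheory.Limits _root_.AlgebraicGeometry
open Literature.AlgebraicGeometry.Resolution

namespace Summit.ResolutionOfSingularities.ResolutionOfSingularities.Theorems.CampaignW82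

/-- **Door 1 hangs on smoothing regular varieties**: `UniversalCells.PrimeFieldToPerfect`
(stmt-ResolutionOfSingularities-15233) follows from `FrobeniusTwistStepRegularAt p M ⊤` at every prime `p` and
every perfect `M` of characteristic `p`. [folklore] -/
theorem primeFieldToPerfect_of_forall_frobeniusTwistStepRegularAt_top
    (h : ∀ (p : ℕ) [Fact p.Prime] (M : Type) [Field M] [CharP M p] [PerfectField M],
      FrobeniusTwistStepRegularAt p M ⊤) :
    Summit.ResolutionOfSingularities.ResolutionOfSingularities.Theses.UniversalCells.PrimeFieldToPerfect :=
  primeFieldToPerfect_of_forall_frobeniusTwistStepDimLe_top fun p _ M _ _ _ =>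
    (frobeniusTwistStepAt_iff_regular p M ⊤).2 (h p M)

/-- **Door 2 hangs on smoothing regular varieties (sharpest form)**: `UniformComplexity.PrimeModelTransfer`
(stmt-ResolutionOfSingularities-8933) follows from `FrobeniusTwistStepRegularAt p M ⊤` at the countably many
constant fields `M = (𝔽_p(s))^{alg} ∩ K` (`K` algebraically closed of characteristic `p`, `s ⊆ K` finite).
[folklore] -/
theorem primeModelTransfer_of_forall_frobeniusTwistStepRegularAt_algClosureFg_top
    (h : ∀ (p : ℕ) [Fact p.Prime] (K : Type) [Field K] [CharP K p] [IsAlgClosed K] (s : Finset K),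
      FrobeniusTwistStepRegularAt p (algebraicClosure (Subfield.closure (↑s : Set K)) K) ⊤) :
    Summit.ResolutionOfSingularities.ResolutionOfSingularities.Theses.UniformComplexity.PrimeModelTransfer :=
  primeModelTransfer_of_forall_frobeniusTwistStepAt_algClosureFg_top fun p _ K _ _ _ s =>
    (frobeniusTwistStepAt_iff_regular p _ ⊤).2 (h p K s)

/-- **Every instance of the regular form follows from the summit**. [folklore] -/
theorem frobeniusTwistStepRegularAt_of_resolutionInChar {p : ℕ} [Fact p.Prime] (h : ResolutionInChar.{0} p)
    (M : Type) [Field M] [CharP M p] (n : WithBot ℕ∞) : FrobeniusTwistStepRegularAt p M n :=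
  frobeniusTwistStepRegularAt_of_frobeniusTwistStepAt (frobeniusTwistStepAt_of_resolutionInChar h M n)

end Summit.ResolutionOfSingularities.ResolutionOfSingularities.Theorems.CampaignW82

end
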